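import Literature.MathematicalPhysics.QuantumFieldTheory.Balaban1983to89.AveragingRT

/-!
# Bałaban 1982–89, cross-paper DEFINITIONS: the lattice calculus of scalar (site) and vector (bond) fields on the tori `T^{(j)}`

HONEST FRAMING (cell `lit-balaban`, verbatim): statement-level skeleton of published theorems with citation tags; proofs
where landed; nothing here is a claim about the Yang–Mills mass gap.

CITATION HEADER.  This module types, on the carriers OF RECORD of the series' shared vocabulary `…Balaban1983to89.Setup`
(`Site P j`, `PBond P j`, `Plaq P j`, `SiteField`, `VecField`, `blockOf`/`emb`/`block`, `Site.blockSite` of `TorusGeometry`),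
the LINEAR lattice calculus that the propagator papers of T. Bałaban use for real- and Lie-algebra-valued fields:
* [Balaban1984PropagatorsI] = *Propagators and renormalization transformations for lattice gauge theories. I*, Comm. Math.
  Phys. **95** (1984) 17–40, §1 pp. 17–21: bond fields (1.1), the plaquette variable / curl `F = ∂A` (1.2), the quadratic action
  (1.3)/(1.5), abelian gauge transformations `A^λ = A − ∂λ` (1.4), the straight contours `[x, x(c)]` and the staircase contours
  `Γ_{y,x}` (1.7), the axial gauge `A(Γ_{y,x}) = 0` (1.10), the linear block averages `Q` (1.11)/(1.18) and `Q'` (1.13)/(1.20) with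
  the identity `Q A^λ = Q A − ∂Q'λ` (1.13)/(1.20), the divergence `∂*` and the Laplacian `Δ` of (1.21), the Feynman-gauge form
  `(1/2α)⟨∂*A, ∂*A⟩` of (1.22);
* [Balaban1983RegularityDecay] = *Regularity and decay of lattice Green's functions*, Comm. Math. Phys. **89** (1983) 571–597,
  (1.1) p. 572: the site block average `(Qφ)(y) = Σ_{x ∈ B(y)} L^{-d} φ(x)` (= `Q'` of [Balaban1984PropagatorsI] (1.13));
* [Balaban1985Averaging] = *Averaging operations for lattice gauge theories*, Comm. Math. Phys. **98** (1985) 17–51, (18) p. 21: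
  the `ℓ²` pairings with the lattice volume element; (14) p. 19: the full linear average;
* [Balaban1984PropagatorsII] = *Propagators and renormalization transformations for lattice gauge theories. II*, Comm. Math. Phys.
  **96** (1984) 223–250, (2.8)–(2.9) p. 224: the generalized Landau gauge as a constrained minimum of `Σ η^d |∂*A^λ|²`;
* [Balaban1985RegularSpaces] = *Spaces of regular gauge field configurations on a lattice and gauge fixing conditions*, Comm.
  Math. Phys. **99** (1985) 75–102, (1.1)–(1.2) p. 76: the covariant lattice derivatives `D_{U,μ}`, `D*_{U,μ}` in a background `U`
  acting through a linear representation `R`, and the covariant divergence of plaquette functions.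
Pages were read on the cell's page renders (`run/shared/lean/pub/pub-balaban/b2b-balaban-ref1/pages/…`), as images.

WHAT IS TYPED AND HOW (conventions = `pub-balaban` NOTATION.md §2.2, verbatim): the FORWARD difference
`(∂_μ f)(x) = c·(f(x + e_μ) − f(x))` and its `ℓ²`-adjoint, the backward-looking `(∂*_μ f)(x) = c·(f(x − e_μ) − f(x))`; the
lattice factor `c = (spacing)⁻¹` (`ε⁻¹`, `η⁻¹`, `(L^jη)⁻¹`, `L⁻¹` on `T^{(1)}_L` in (1.9)) is an explicit real PARAMETER because
`Setup` treats spacings as bookkeeping reals (`Params.eps/eta`, `TorusGeometry.spacing`; DIVERGENCE F2/F7 of that cell).  Blocks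
are the CENTRED blocks of `Setup`/`TorusGeometry` (B12 (0.1)/(0.3), `L` odd) — [Balaban1984PropagatorsI] (1.6) anchors `B(y)` at
its corner; every statement below is translation-covariant, the anchor only enters `IsAxial` (flagged there; DIVERGENCE F3).
Block sums are written over the offset parametrisation `Site.blockSite y r`, `r : Fin d → Fin L` (`TorusGeometry.blockEquiv`:
in the standing range `j + 1 ≤ m + K` this is exactly `Σ_{x ∈ B(y)}`, theorem `siteAvg_eq_blockSum`).

RELATION TO EXISTING TREE MATERIAL (not duplicated; different carriers): the same operators are typed per paper on the
momentum/matrix carriers `Tor N`, `Tor N × Fin d` (`B5Action121.sdiff/divS/LapS/CurlOp/gaugeT/actionS`, `B5Prop11Lattice.grad/divT`,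
`B5RealFields.*`), on `ℤ^d` (`B12Rep537.fdelta`, `B12Pairing543.curl/grad`, `GawedzkiKupiainen1985.PeriodicGleason.delta`) and for
the adjoint bundle (`T4AdjointCovariance.covDeriv`, bond-field valued, no lattice factor); `Setup.LinAveraging` is the AXIOMATIC
linear average (linearity + locality) of which `bondAvg` below is the printed formula.  Nothing here asserts a theorem of the series;
the proved statements are the elementary identities the papers use without comment (`∂∂λ = 0` on plaquettes, `∂*` adjoint to `∂`,
gauge invariance of the quadratic action, telescoping of `∂λ` along a straight contour, `Q∂ = ∂Q'`).

Unit `lit-balaban-r18` (READER/TYPER r18, cross-paper definitions pass), 2026-08-20.  v1.1 (same day, append-only): §9 = the full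
linear average (1.8)/(14) with `fullBondAvg_of_isAxial`, `∂*∂ = Δ`, `∂*A^λ = ∂*A − Δλ`, and the abelian one-level block Landau gauge
([Balaban1984PropagatorsII] (2.8)–(2.9)).  v1.2 (2026-08-21, append-only; lit-balaban lead R8): §10 = the adjoint `Q(A)^*` and the
projection `P(A) = Q(A)^*Q(A)` of [Balaban1983RegularityDecay] (1.5), with `Q(A)^*` adjoint to `Q(A)` (`covSiteAvg_adjoint`),
`Q(A)Q(A)^* = I` and `P(A)² = P(A)` PROVED (one level, standing range).
-/

open scoped BigOperators

namespace Literature.MathematicalPhysics.QuantumFieldTheory.Balaban1983to89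

namespace LatticeFieldCalculus

/-! ## 1. Site arithmetic on the torus `T^{(j)}` (helpers) -/

section SiteLemmas

variable {P : Params} {j : ℕ}

/-- `(x + e_μ)_μ = x_μ + 1`. [folklore] -/
@[simp] private theorem shift_apply_self (x : Site P j) (μ : Fin P.d) : x.shift μ μ = x μ + 1 := by
  simp [Site.shift]

/-- `(x + e_μ)_ν = x_ν` for `ν ≠ μ`. [folklore] -/
private theorem shift_apply_ne (x : Site P j) {μ ν : Fin P.d} (h : ν ≠ μ) : x.shift μ ν = x ν := by
  simp [Site.shift, Function.update_of_ne h]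

/-- `(x - e_μ)_μ = x_μ - 1`. [folklore] -/
@[simp] private theorem unshift_apply_self (x : Site P j) (μ : Fin P.d) : x.unshift μ μ = x μ - 1 := by
  simp [Site.unshift]

/-- `(x - e_μ)_ν = x_ν` for `ν ≠ μ`. [folklore] -/
private theorem unshift_apply_ne (x : Site P j) {μ ν : Fin P.d} (h : ν ≠ μ) : x.unshift μ ν = x ν := by
  simp [Site.unshift, Function.update_of_ne h]

/-- `(x + e_μ) - e_μ = x`. [folklore] -/
@[simp] private theorem unshift_shift (x : Site P j) (μ : Fin P.d) : (x.shift μ).unshift μ = x := by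
  funext ν
  by_cases h : ν = μ
  · subst h; simp
  · rw [unshift_apply_ne _ h, shift_apply_ne _ h]

/-- `(x - e_μ) + e_μ = x`. [folklore] -/
@[simp] private theorem shift_unshift (x : Site P j) (μ : Fin P.d) : (x.unshift μ).shift μ = x := by
  funext ν
  by_cases h : ν = μ
  · subst h; simp
  · rw [shift_apply_ne _ h, unshift_apply_ne _ h]

/-- Lattice translations commute: `(x + e_μ) + e_ν = (x + e_ν) + e_μ`. [folklore] -/
private theorem shift_comm (x : Site P j) (μ ν : Fin P.d) : (x.shift μ).shift ν = (x.shift ν).shift μ := by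
  funext κ
  by_cases h1 : κ = ν
  · subst h1
    by_cases h2 : κ = μ
    · subst h2; rfl
    · rw [shift_apply_self, shift_apply_ne _ h2, shift_apply_ne _ h2, shift_apply_self]
  · by_cases h2 : κ = μ
    · subst h2
      rw [shift_apply_ne _ h1, shift_apply_self, shift_apply_self, shift_apply_ne _ h1]
    · rw [shift_apply_ne _ h1, shift_apply_ne _ h2, shift_apply_ne _ h2, shift_apply_ne _ h1]

/-- `x ↦ x + e_μ` as a permutation of the sites of `T^{(j)}` (inverse `x ↦ x - e_μ`). [folklore] -/
def shiftEquiv (μ : Fin P.d) : Site P j ≃ Site P j where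
  toFun x := x.shift μ
  invFun x := x.unshift μ
  left_inv x := unshift_shift x μ
  right_inv x := shift_unshift x μ

/-- Positively oriented bonds are pairs (site, direction). [folklore] -/
def bondEquiv : Site P j × Fin P.d ≃ PBond P j where
  toFun p := ⟨p.1, p.2⟩
  invFun b := (b.src, b.dir)
  left_inv _ := rfl
  right_inv _ := rfl

/-- A sum over bonds is a double sum over sites and directions. [folklore] -/
private theorem sum_bond_eq {α : Type*} [AddCommMonoid α] (F : PBond P j → α) :
    ∑ b : PBond P j, F b = ∑ x : Site P j, ∑ μ : Fin P.d, F ⟨x, μ⟩ :=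
  calc ∑ b : PBond P j, F b = ∑ p : Site P j × Fin P.d, F (bondEquiv p) :=
        (Equiv.sum_comp (bondEquiv (P := P) (j := j)) F).symm
    _ = ∑ x : Site P j, ∑ μ : Fin P.d, F ⟨x, μ⟩ := Fintype.sum_prod_type _

end SiteLemmas

/-! ## 2. The linear lattice calculus: `∂_μ`, `∂*_μ`, `∂` (site → bond), `∂*` (bond → site), the curl on plaquettes, `Δ`
([Balaban1984PropagatorsI] (1.1)–(1.4), (1.21)) -/

section Calculus

variable {P : Params} {j : ℕ} {V : Type*} [AddCommGroup V] [Module ℝ V]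

/-- FORWARD partial difference `(∂_μ f)(x) = c·(f(x + e_μ) − f(x))`, `c` = (lattice spacing)⁻¹ ([Balaban1984PropagatorsI] (1.2):
`F_{μν} = ∂_μ A_ν − ∂_ν A_μ` with this `∂_μ`; NOTATION §2.2 of `pub-balaban`). [cite: Balaban1984PropagatorsI, (1.2) p.18] -/
def pdiff (c : ℝ) (μ : Fin P.d) (f : SiteField P j V) : SiteField P j V :=
  fun x => c • (f (x.shift μ) - f x)

/-- BACKWARD-LOOKING partial difference `(∂*_μ f)(x) = c·(f(x − e_μ) − f(x))`, the `ℓ²`-adjoint of `∂_μ`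
([Balaban1984PropagatorsI] (1.21): "`∂*` is the divergence operator for vector functions, `∂*A = Σ_μ ∂*_μ A_μ`"). [cite: Balaban1984PropagatorsI, (1.21) p.21] -/
def pdiffAdj (c : ℝ) (μ : Fin P.d) (f : SiteField P j V) : SiteField P j V :=
  fun x => c • (f (x.unshift μ) - f x)

/-- The lattice GRADIENT of a site function as a bond field: `(∂λ)(b) = c·(λ(b₊) − λ(b₋))`, `b = ⟨b₋, b₊⟩`
([Balaban1984PropagatorsI] (1.4); on the `L`-lattice `T^{(1)}_L` the factor is `L⁻¹`, (1.9)). [cite: Balaban1984PropagatorsI, (1.4) p.18] -/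
def grad (c : ℝ) (lam : SiteField P j V) : VecField P j V :=
  fun b => c • (lam b.tgt - lam b.src)

/-- The lattice DIVERGENCE of a bond field: `(∂*A)(x) = Σ_μ (∂*_μ A_μ)(x) = Σ_μ c·(A(x − e_μ, μ) − A(x, μ))`
([Balaban1984PropagatorsI] (1.21)). [cite: Balaban1984PropagatorsI, (1.21) p.21] -/
def diverg (c : ℝ) (A : VecField P j V) : SiteField P j V :=
  fun x => ∑ μ : Fin P.d, c • (A ⟨x.unshift μ, μ⟩ - A ⟨x, μ⟩)

/-- The PLAQUETTE VARIABLE (curl) of a bond field: for `p = ⟨x, x + e_μ, x + e_μ + e_ν, x + e_ν⟩`, `μ < ν`,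
`F(p) = (∂A)(p) = c·A(∂p) = c·(A(x, x+e_μ) + A(x+e_μ, x+e_μ+e_ν) − A(x+e_ν, x+e_ν+e_μ) − A(x, x+e_ν)) = (∂_μ A_ν)(x) − (∂_ν A_μ)(x)`
(reversed bonds enter with a minus sign, `A_{⟨x,x'⟩} = −A_{⟨x',x⟩}`). [cite: Balaban1984PropagatorsI, (1.2) p.18] -/
def curl (c : ℝ) (A : VecField P j V) (p : Plaq P j) : V :=
  c • (A ⟨p.src, p.μ⟩ + A ⟨p.src.shift p.μ, p.ν⟩ - A ⟨p.src.shift p.ν, p.μ⟩ - A ⟨p.src, p.ν⟩)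

/-- The (positive) lattice LAPLACIAN of a site function, `Δ = Σ_μ ∂*_μ ∂_μ`:
`(Δf)(x) = Σ_μ c²·(2 f(x) − f(x + e_μ) − f(x − e_μ))` ([Balaban1984PropagatorsI] (1.21): "`Δ` is `η`-lattice Laplace operator
for scalar functions", with `⟨∂A, ∂A⟩ = Σ_μ ⟨A_μ, ΔA_μ⟩ − ⟨∂*A, ∂*A⟩`). [cite: Balaban1984PropagatorsI, (1.21) p.21] -/
def laplace (c : ℝ) (f : SiteField P j V) : SiteField P j V :=
  fun x => ∑ μ : Fin P.d, (c ^ 2) • (f x + f x - f (x.shift μ) - f (x.unshift μ))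

/-- The abelian GAUGE TRANSFORMATION of a bond field by a site function: `A^λ_b = A_b − (∂λ)(b)`. [cite: Balaban1984PropagatorsI, (1.4) p.18] -/
def gaugeShift (c : ℝ) (lam : SiteField P j V) (A : VecField P j V) : VecField P j V :=
  fun b => A b - grad c lam b

/-- The `μ`-component of the gradient is the forward difference: `(∂λ)(⟨x, x+e_μ⟩) = (∂_μ λ)(x)`. [cite: Balaban1984PropagatorsI, (1.2) p.18] -/
theorem grad_apply (c : ℝ) (lam : SiteField P j V) (x : Site P j) (μ : Fin P.d) :
    grad c lam ⟨x, μ⟩ = pdiff c μ lam x := rfl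

/-- `∂*A = Σ_μ ∂*_μ A_μ` componentwise. [cite: Balaban1984PropagatorsI, (1.21) p.21] -/
theorem diverg_apply (c : ℝ) (A : VecField P j V) (x : Site P j) :
    diverg c A x = ∑ μ : Fin P.d, pdiffAdj c μ (fun z => A ⟨z, μ⟩) x := rfl

/-- `Δ = Σ_μ ∂*_μ ∂_μ`. [cite: Balaban1984PropagatorsI, (1.21) p.21] -/
theorem laplace_apply (c : ℝ) (f : SiteField P j V) (x : Site P j) :
    laplace c f x = ∑ μ : Fin P.d, pdiffAdj c μ (pdiff c μ f) x := by
  simp only [laplace, pdiffAdj, pdiff]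
  refine Finset.sum_congr rfl fun μ _ => ?_
  rw [shift_unshift]
  module

/-- `F(p) = (∂_μ A_ν)(x) − (∂_ν A_μ)(x)` for `p = p_{μν}(x)`. [cite: Balaban1984PropagatorsI, (1.2) p.18] -/
theorem curl_eq_pdiff (c : ℝ) (A : VecField P j V) (p : Plaq P j) :
    curl c A p = pdiff c p.μ (fun z => A ⟨z, p.ν⟩) p.src - pdiff c p.ν (fun z => A ⟨z, p.μ⟩) p.src := by
  simp only [curl, pdiff]
  module

/-- THE GRADIENT IS CURL-FREE: `(∂(∂λ))(p) = 0` on every plaquette (used in "the covariant derivative `∂A`, and so the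
action above, are invariant with respect to … gauge transformations", [Balaban1984PropagatorsI] p. 18). [cite: Balaban1984PropagatorsI, (1.4) p.18] -/
theorem curl_grad (c c' : ℝ) (lam : SiteField P j V) (p : Plaq P j) : curl c (grad c' lam) p = 0 := by
  simp only [curl, grad, PBond.tgt]
  rw [shift_comm p.src p.ν p.μ]
  module

/-- `∂` is additive on bond fields (it is a linear operator, [Balaban1984PropagatorsI] (1.2)). [cite: Balaban1984PropagatorsI, (1.2) p.18] -/
theorem curl_add (c : ℝ) (A B : VecField P j V) (p : Plaq P j) :
    curl c (fun b => A b + B b) p = curl c A p + curl c B p := by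
  simp only [curl]; module

/-- `∂` commutes with subtraction of bond fields (linearity, [Balaban1984PropagatorsI] (1.2)). [cite: Balaban1984PropagatorsI, (1.2) p.18] -/
theorem curl_sub (c : ℝ) (A B : VecField P j V) (p : Plaq P j) :
    curl c (fun b => A b - B b) p = curl c A p - curl c B p := by
  simp only [curl]; module

/-- GAUGE INVARIANCE OF THE PLAQUETTE VARIABLE: `∂(A − ∂λ) = ∂A`. [cite: Balaban1984PropagatorsI, (1.4) p.18] -/
theorem curl_gaugeShift (c c' : ℝ) (lam : SiteField P j V) (A : VecField P j V) (p : Plaq P j) :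
    curl c (gaugeShift c' lam A) p = curl c A p := by
  unfold gaugeShift
  rw [curl_sub, curl_grad, sub_zero]

/-- The averaged-field form of a gauge transformation, [Balaban1984PropagatorsI] (1.9)/(1.13): a CONSTANT `λ` does not move `A`. [cite: Balaban1984PropagatorsI, (1.9) p.19] -/
theorem gaugeShift_const (c : ℝ) (v : V) (A : VecField P j V) : gaugeShift c (fun _ => v) A = A := by
  funext b; simp [gaugeShift, grad]

end Calculus

/-! ## 3. `∂*` is the adjoint of `∂` (summation by parts on the torus) ([Balaban1984PropagatorsI] (1.21); NOTATION §2.2) -/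

section Adjoint

variable {P : Params} {j : ℕ}

/-- Reindexing a site sum by the translation `x ↦ x - e_μ`. [folklore] -/
private theorem sum_comp_unshift {α : Type*} [AddCommMonoid α] (μ : Fin P.d) (g : Site P j → α) :
    ∑ x : Site P j, g (x.unshift μ) = ∑ x : Site P j, g x :=
  Equiv.sum_comp (shiftEquiv (P := P) (j := j) μ).symm g

/-- SUMMATION BY PARTS in one direction: `Σ_x (∂_μ f)(x) g(x) = Σ_x f(x) (∂*_μ g)(x)`. [cite: Balaban1984PropagatorsI, (1.21) p.21] -/
theorem sum_pdiff_mul (c : ℝ) (μ : Fin P.d) (f g : SiteField P j ℝ) :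
    ∑ x : Site P j, pdiff c μ f x * g x = ∑ x : Site P j, f x * pdiffAdj c μ g x := by
  simp only [pdiff, pdiffAdj, smul_eq_mul]
  have h := sum_comp_unshift (P := P) (j := j) μ (fun x => f (x.shift μ) * g x)
  simp only [shift_unshift] at h
  calc ∑ x : Site P j, c * (f (x.shift μ) - f x) * g x
      = c * (∑ x : Site P j, f (x.shift μ) * g x) - c * ∑ x : Site P j, f x * g x := by
        rw [Finset.mul_sum, Finset.mul_sum, ← Finset.sum_sub_distrib]
        exact Finset.sum_congr rfl fun x _ => by ring
    _ = c * (∑ x : Site P j, f x * g (x.unshift μ)) - c * ∑ x : Site P j, f x * g x := by rw [h]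
    _ = ∑ x : Site P j, f x * (c * (g (x.unshift μ) - g x)) := by
        rw [Finset.mul_sum, Finset.mul_sum, ← Finset.sum_sub_distrib]
        exact Finset.sum_congr rfl fun x _ => by ring

/-- `∂*` IS THE `ℓ²`-ADJOINT OF `∂` on the torus: `Σ_b (∂λ)(b) A(b) = Σ_x λ(x) (∂*A)(x)` (real-valued fields; the common volume
factor `η^d` of both pairings (B7 (18)) is omitted). [cite: Balaban1984PropagatorsI, (1.21) p.21] -/
theorem sum_grad_mul (c : ℝ) (lam : SiteField P j ℝ) (A : VecField P j ℝ) :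
    ∑ b : PBond P j, grad c lam b * A b = ∑ x : Site P j, lam x * diverg c A x := by
  rw [sum_bond_eq]
  simp only [diverg, Finset.mul_sum]
  conv_lhs => rw [Finset.sum_comm]
  conv_rhs => rw [Finset.sum_comm]
  refine Finset.sum_congr rfl fun μ _ => ?_
  have h := sum_pdiff_mul (P := P) (j := j) c μ lam (fun z => A ⟨z, μ⟩)
  simpa only [grad_apply, pdiffAdj, smul_eq_mul] using h

end Adjoint

/-! ## 4. Quadratic forms: the abelian action, the `ℓ²` pairings, the Feynman-gauge form
([Balaban1984PropagatorsI] (1.3), (1.5), (1.21), (1.22); [Balaban1985Averaging] (18)) -/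

section Forms

variable {P : Params} {j : ℕ} {V : Type*} [NormedAddCommGroup V] [NormedSpace ℝ V]

/-- The `ℓ²` PAIRING of real site functions with the lattice volume element `w = η^d`: `⟨f, g⟩ = Σ_x η^d f(x) g(x)`
([Balaban1985Averaging] (18), scalar case). [cite: Balaban1985Averaging, (18) p.21] -/
def sitePairing (w : ℝ) (f g : SiteField P j ℝ) : ℝ := ∑ x : Site P j, w * (f x * g x)

/-- The `ℓ²` pairing of real bond fields ("similarly for functions defined at bonds or plaquettes", [Balaban1985Averaging] p. 21). [cite: Balaban1985Averaging, (18) p.21] -/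
def bondPairing (w : ℝ) (A B : VecField P j ℝ) : ℝ := ∑ b : PBond P j, w * (A b * B b)

/-- THE ABELIAN (free-field) ACTION `S^ε(A) = ½ Σ_p ε^d |F(p)|² = ½ Σ_p ε^d |(∂A)(p)|²`, weight `w = ε^d`, lattice factor `c = ε⁻¹`
inside `∂`; the unit-lattice action (1.5) is `w = c = 1`.  Values in a normed space (`ℝ` in [Balaban1984PropagatorsI]; the
Lie algebra with its Hilbert–Schmidt norm in the later papers). [cite: Balaban1984PropagatorsI, (1.3) p.18] -/
noncomputable def curlAction (w c : ℝ) (A : VecField P j V) : ℝ :=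
  (1 / 2) * ∑ p : Plaq P j, w * ‖curl c A p‖ ^ 2

/-- The FEYNMAN-GAUGE (Faddeev–Popov) form `(1/2α) ⟨∂*A, ∂*A⟩ = (1/2α) Σ_x η^d |(∂*A)(x)|²` inserted under the integral (1.17). [cite: Balaban1984PropagatorsI, (1.22) p.21] -/
noncomputable def divergenceForm (w c α : ℝ) (A : VecField P j V) : ℝ :=
  (1 / (2 * α)) * ∑ x : Site P j, w * ‖diverg c A x‖ ^ 2

/-- The abelian action (1.3) is a nonnegative quadratic form (for `ε^d ≥ 0`). [cite: Balaban1984PropagatorsI, (1.3) p.18] -/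
theorem curlAction_nonneg {w : ℝ} (hw : 0 ≤ w) (c : ℝ) (A : VecField P j V) : 0 ≤ curlAction w c A := by
  unfold curlAction
  exact mul_nonneg (by norm_num) (Finset.sum_nonneg fun p _ => mul_nonneg hw (sq_nonneg _))

/-- GAUGE INVARIANCE OF THE ACTION: `S(A − ∂λ) = S(A)` ("This invariance of the action (1.3) is a fundamental symmetry of the
theory", [Balaban1984PropagatorsI] p. 18). [cite: Balaban1984PropagatorsI, (1.4) p.18] -/
theorem curlAction_gaugeShift (w c c' : ℝ) (lam : SiteField P j V) (A : VecField P j V) :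
    curlAction w c (gaugeShift c' lam A) = curlAction w c A := by
  unfold curlAction
  simp only [curl_gaugeShift]

end Forms

/-! ## 5. Straight contours and the linear block averages `Q'` (sites) and `Q` (bonds)
([Balaban1983RegularityDecay] (1.1); [Balaban1984PropagatorsI] (1.7)–(1.8), (1.11), (1.13), (1.18), (1.20)) -/

section Averages

variable {P : Params} {j : ℕ} {V : Type*} [AddCommGroup V] [Module ℝ V]

/-- The site `x + t e_μ` (`t` steps from `x` in the direction `μ`). [folklore] -/
def runSite (x : Site P j) (μ : Fin P.d) (t : ℕ) : Site P j := Function.update x μ (x μ + t)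

/-- The `t`-th bond `⟨x + t e_μ, x + (t+1) e_μ⟩` of the straight contour issuing from `x` in the direction `μ`. [cite: Balaban1984PropagatorsI, (1.7) p.18] -/
def runBond (x : Site P j) (μ : Fin P.d) (t : ℕ) : PBond P j := ⟨runSite x μ t, μ⟩

/-- `x + 0·e_μ = x`: the straight contour of (1.7) starts at `x`. [cite: Balaban1984PropagatorsI, (1.7) p.18] -/
@[simp] theorem runSite_zero (x : Site P j) (μ : Fin P.d) : runSite x μ 0 = x := by
  simp [runSite]

/-- `x + (t+1) e_μ = (x + t e_μ) + e_μ`: consecutive sites of the straight contour of (1.7) are nearest neighbours. [cite: Balaban1984PropagatorsI, (1.7) p.18] -/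
theorem runSite_succ (x : Site P j) (μ : Fin P.d) (t : ℕ) : runSite x μ (t + 1) = (runSite x μ t).shift μ := by
  simp only [runSite, Site.shift, Function.update_idem, Function.update_self]
  push_cast
  rw [add_assoc]

/-- `A([x, x + n e_μ]) = Σ_{b ⊂ [x, x + n e_μ]} A_b`: the sum of a bond field along the straight contour of `n` bonds from `x` in the
direction `μ` ("`A(Γ) = Σ_{b ⊂ Γ} A_b` for arbitrary contour `Γ`"; `n = L`, `μ = ` the direction of the coarse bond `c` gives
`A([x, x(c)])`). [cite: Balaban1984PropagatorsI, (1.8) p.19] -/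
def segSum (A : VecField P j V) (x : Site P j) (μ : Fin P.d) (n : ℕ) : V :=
  ∑ t ∈ Finset.range n, A (runBond x μ t)

/-- TELESCOPING: `(∂λ)([x, x + n e_μ]) = c·(λ(x + n e_μ) − λ(x))`. [cite: Balaban1984PropagatorsI, (1.9) p.19] -/
theorem segSum_grad (c : ℝ) (lam : SiteField P j V) (x : Site P j) (μ : Fin P.d) (n : ℕ) :
    segSum (grad c lam) x μ n = c • (lam (runSite x μ n) - lam x) := by
  induction n with
  | zero => simp [segSum]
  | succ n ih =>
    rw [segSum, Finset.sum_range_succ, ← segSum, ih, runSite_succ]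
    simp only [grad, runBond, PBond.tgt]
    module

/-- THE SITE BLOCK AVERAGE `(Q'λ)(y) = Σ_{x ∈ B(y)} L^{-d} λ(x)` ([Balaban1984PropagatorsI] (1.13); = the `Q` of
[Balaban1983RegularityDecay] (1.1) on scalar fields), written over the offset parametrisation of the CENTRED block `B(y)`
(`siteAvg_eq_blockSum`). [cite: Balaban1984PropagatorsI, (1.13) p.19] -/
noncomputable def siteAvg (lam : SiteField P j V) : SiteField P (j + 1) V :=
  fun y => (((P.L : ℝ) ^ P.d)⁻¹) • ∑ r : Fin P.d → Fin P.L, lam (Site.blockSite y r)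

/-- THE BOND BLOCK AVERAGE `(QA)(c) = Σ_{x ∈ B(c₋)} L^{-(d+1)} A([x, x(c)])`, `x(c) = x + L e_μ ∈ B(c₊)` for `c = ⟨y, y + L e_μ⟩`
([Balaban1984PropagatorsI] (1.11); the averaging operation "given by `Q` directly", p. 19), over the offset parametrisation of the
centred block. [cite: Balaban1984PropagatorsI, (1.11) p.19] -/
noncomputable def bondAvg (A : VecField P j V) : VecField P (j + 1) V :=
  fun c => (((P.L : ℝ) ^ (P.d + 1))⁻¹) • ∑ r : Fin P.d → Fin P.L, segSum A (Site.blockSite c.src r) c.dir P.L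

/-- The ITERATED site average `Q'_k` from the finest lattice `T^{(0)}` to `T^{(k)}` ("`(Q'_kλ)(y) = Σ_{x ∈ B^k(y)} η^d λ(x)`",
[Balaban1984PropagatorsI] (1.20)), defined as the `k`-fold composition (the printed one-stroke formula is its unfolding). [cite: Balaban1984PropagatorsI, (1.20) p.20] -/
noncomputable def siteAvgIter : (k : ℕ) → SiteField P 0 V → SiteField P k V
  | 0 => id
  | k + 1 => siteAvg ∘ siteAvgIter k

/-- The ITERATED bond average `Q_k` ("a composition of `k` transformations", [Balaban1984PropagatorsI] (1.16)–(1.18):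
`(Q_kA)_b = Σ_{x ∈ B^k(b₋)} η^{d+1} A([x, x(b)])`), defined as the `k`-fold composition. [cite: Balaban1984PropagatorsI, (1.18) p.20] -/
noncomputable def bondAvgIter : (k : ℕ) → VecField P 0 V → VecField P k V
  | 0 => id
  | k + 1 => bondAvg ∘ bondAvgIter k

/-- In the standing range the offset sum IS the sum over the block `B(y) = {x : blockOf x = y}` of `Setup`:
`(Q'λ)(y) = L^{-d} Σ_{x ∈ B(y)} λ(x)`. [cite: Balaban1983RegularityDecay, (1.1) p.572] -/
theorem siteAvg_eq_blockSum (hj : j + 1 ≤ P.m + P.K) (lam : SiteField P j V) (y : Site P (j + 1)) :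
    siteAvg lam y = (((P.L : ℝ) ^ P.d)⁻¹) • ∑ x ∈ block y, lam x := by
  unfold siteAvg
  congr 1
  have hmem : ∀ x : Site P j, blockOf x = y ↔ x ∈ block y := fun x => by simp [block]
  let e : (Fin P.d → Fin P.L) ≃ ↥(block y) := (Site.blockEquiv hj y).symm.trans (Equiv.subtypeEquivRight hmem)
  rw [← Finset.sum_coe_sort (block y) lam, ← Equiv.sum_comp e (fun a => lam a.1)]
  exact Finset.sum_congr rfl fun r _ => rfl

/-- `Q'` REPRODUCES BLOCK CONSTANTS: for `λ` constant (on each block), `Q'λ` is that constant ([Balaban1984PropagatorsI] (1.15): "defining `λ` on `T₁` as constant on each block, `λ(x) = λ₁(y)` for `x ∈ B(y)`"). [cite: Balaban1984PropagatorsI, (1.15) p.19] -/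
theorem siteAvg_const (v : V) (y : Site P (j + 1)) : siteAvg (P := P) (j := j) (fun _ => v) y = v := by
  unfold siteAvg
  rw [Finset.sum_const, Finset.card_univ, Fintype.card_fun, Fintype.card_fin, Fintype.card_fin, ← Nat.cast_smul_eq_nsmul ℝ,
    smul_smul]
  have hL : ((P.L : ℝ) ^ P.d) ≠ 0 := pow_ne_zero _ (Nat.cast_ne_zero.mpr P.L_pos.ne')
  rw [Nat.cast_pow, inv_mul_cancel₀ hL, one_smul]

/-- The end of the straight contour `[x, x(c)]`: for `x = blockSite y r ∈ B(y)`, `x + L e_μ` is the site with the SAME offset in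
the next block `B(y + e_μ)` (standing range; this is "`x(c)` … obtained by translation of `x` by the bond `c`",
[Balaban1984PropagatorsI] p. 19, in the centred labelling). [cite: Balaban1984PropagatorsI, (1.8) p.19] -/
theorem runSite_blockSite_L (hj : j + 1 ≤ P.m + P.K) (y : Site P (j + 1)) (r : Fin P.d → Fin P.L) (μ : Fin P.d) :
    runSite (Site.blockSite y r) μ P.L = Site.blockSite (y.shift μ) r := by
  funext ν
  by_cases hν : ν = μ
  · subst hν
    simp only [runSite, Function.update_self, Site.blockSite, Site.shift]
    rw [AveragingRT.cast_succ_mul_L hj]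
    push_cast
    ring
  · simp only [runSite, Function.update_of_ne hν, Site.blockSite, Site.shift]

/-- `Q ∂ = ∂ Q'` ([Balaban1984PropagatorsI] (1.13): `B^λ_c = B_c − L⁻¹((Q'λ)(c₊) − (Q'λ)(c₋)) = B_c − (∂Q'λ)(c)`; (1.20):
`Q_k A^λ = Q_k A − ∂Q'_k λ`): the block average of a gradient is the coarse gradient (lattice factor `c/L`) of the site average
(standing range). [cite: Balaban1984PropagatorsI, (1.13) p.19] -/
theorem bondAvg_grad (hj : j + 1 ≤ P.m + P.K) (c : ℝ) (lam : SiteField P j V) :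
    bondAvg (grad c lam) = grad (c / P.L) (siteAvg lam) := by
  funext b
  simp only [bondAvg, segSum_grad, runSite_blockSite_L hj]
  simp only [grad, siteAvg, PBond.tgt]
  rw [← Finset.smul_sum, Finset.sum_sub_distrib]
  have hL : (P.L : ℝ) ≠ 0 := Nat.cast_ne_zero.mpr P.L_pos.ne'
  match_scalars <;> field_simp <;> ring

/-- THE GAUGE COVARIANCE OF THE LINEAR AVERAGE, [Balaban1984PropagatorsI] (1.13)/(1.20): `Q(A − ∂λ) = QA − ∂(Q'λ)` with the coarse
lattice factor `c/L` (standing range). [cite: Balaban1984PropagatorsI, (1.20) p.20] -/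
theorem bondAvg_gaugeShift (hj : j + 1 ≤ P.m + P.K) (c : ℝ) (lam : SiteField P j V) (A : VecField P j V) :
    bondAvg (gaugeShift c lam A) = gaugeShift (c / P.L) (siteAvg lam) (bondAvg A) := by
  have hlin : bondAvg (gaugeShift c lam A) = fun b => bondAvg A b - bondAvg (grad c lam) b := by
    funext b
    simp only [bondAvg, gaugeShift, segSum, Finset.sum_sub_distrib, smul_sub]
  rw [hlin, bondAvg_grad hj]
  rfl

end Averages

/-! ## 6. Staircase contours `Γ_{y,x}` and the axial gauge for vector fields ([Balaban1984PropagatorsI] (1.7), (1.10);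
[Balaban1987RG1] p. 252) -/

section Axial

variable {P : Params} {j : ℕ} {V : Type*} [AddCommGroup V] [Module ℝ V]

/-- SIGNED sum of a bond field along the straight run of `n ∈ ℤ` steps from `x` in the direction `μ`: forward bonds for `n ≥ 0`,
for `n < 0` the bonds `⟨x − (t+1)e_μ, x − t e_μ⟩` traversed backwards, each with a minus sign (`A_{⟨x,x'⟩} = −A_{⟨x',x⟩}`,
[Balaban1984PropagatorsI] p. 18). [cite: Balaban1984PropagatorsI, (1.7) p.18] -/
def runSum (A : VecField P j V) (x : Site P j) (μ : Fin P.d) : ℤ → V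
  | (n : ℕ) => ∑ t ∈ Finset.range n, A ⟨runSite x μ t, μ⟩
  | Int.negSucc n => -∑ t ∈ Finset.range (n + 1), A ⟨Function.update x μ (x μ - (t + 1 : ℕ)), μ⟩

/-- The corner `(y_1, …, y_μ, x_{μ+1}, …, x_d)` of the staircase `Γ_{y,x}` at which the coordinate `μ` starts to change
(coordinates are changed in the order `d, d−1, …, 1`). [cite: Balaban1984PropagatorsI, (1.7) p.18] -/
def mixSite (μ : Fin P.d) (y x : Site P j) : Site P j := fun ν => if μ < ν then x ν else y ν

/-- `A(Γ_{y,x})`: the sum of a bond field along the STAIRCASE CONTOUR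
`Γ_{y,x} = [y, (y_1,…,y_{d−1},x_d)] ∪ … ∪ [(y_1,x_2,…,x_d), x]` ([Balaban1984PropagatorsI] (1.7); [Balaban1987RG1] p. 252: the
shortest contour changing the coordinates in the order `d, …, 1`), the displacement in each coordinate being read as the
representative of `x_μ − y_μ` of least absolute value (`ZMod.valMinAbs`; for `x ∈ B(y)` this is the printed `|n_μ| ≤ (L−1)/2`).
As a SUM the order of the runs is immaterial. [cite: Balaban1984PropagatorsI, (1.7) p.18] -/
def stairSum (A : VecField P j V) (y x : Site P j) : V :=
  ∑ μ : Fin P.d, runSum A (mixSite μ y x) μ ((x μ - y μ).valMinAbs)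

/-- THE AXIAL GAUGE for vector fields: `A(Γ_{y,x}) = 0` for every coarse site `y`, every `x ∈ B(y)`, `x ≠ y`
([Balaban1984PropagatorsI] (1.10): `δ_Ax(A) = Π_y Π_{x ∈ B(y), x ≠ y} δ(A(Γ_{y,x}))`).  CONVENTION FLAG (DIVERGENCE F3 of
`pub-balaban`): typed for the CENTRED blocks of `Setup` (`y ↦ emb y`, `B(y)` parametrised by `Site.blockSite`), as
`Setup.AxialGauge` is; [Balaban1984PropagatorsI] (1.6) anchors the block and `Γ_{y,x}` at the corner. [cite: Balaban1984PropagatorsI, (1.10) p.19] -/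
def IsAxial (A : VecField P j V) : Prop :=
  ∀ (y : Site P (j + 1)) (r : Fin P.d → Fin P.L), Site.blockSite y r ≠ emb y → stairSum A (emb y) (Site.blockSite y r) = 0

omit [Module ℝ V] in
/-- A run of zero steps is the empty contour: it contributes nothing to `A(Γ)`. [cite: Balaban1984PropagatorsI, (1.7) p.18] -/
@[simp] theorem runSum_zero (A : VecField P j V) (x : Site P j) (μ : Fin P.d) : runSum A x μ 0 = 0 := by
  simp [runSum]

omit [Module ℝ V] in
/-- For `n ≥ 0` steps the signed run sum is the straight-contour sum `A([x, x + n e_μ])` of (1.8). [cite: Balaban1984PropagatorsI, (1.8) p.19] -/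
theorem runSum_ofNat (A : VecField P j V) (x : Site P j) (μ : Fin P.d) (n : ℕ) :
    runSum A x μ (n : ℤ) = segSum A x μ n := rfl

omit [Module ℝ V] in
/-- `Γ_{y,y}` is the empty contour, `A(Γ_{y,y}) = 0` (whence the axial conditions (1.10) are imposed only for `x ≠ y`). [cite: Balaban1984PropagatorsI, (1.10) p.19] -/
theorem stairSum_self (A : VecField P j V) (y : Site P j) : stairSum A y y = 0 := by
  simp [stairSum]

end Axial

/-! ## 7. Covariant lattice derivatives in a background field ([Balaban1985RegularSpaces] (1.1)–(1.2); [Balaban1985BackgroundPropagators] (3.3)) -/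

section Covariant

variable {P : Params} {j : ℕ} {G : Type*} [GaugeGroup G] {V : Type*} [AddCommGroup V] [Module ℝ V]

/-- THE COVARIANT FORWARD DERIVATIVE of a site function with values in a representation space of the gauge group:
`(D_{U,μ}F)(x) = c·(R(U(x, x+e_μ)) F(x+e_μ) − F(x))`, `R` a linear action of `G` on `V` (printed: `R(U)X = UXU⁻¹` on matrices),
`c = η⁻¹`. [cite: Balaban1985RegularSpaces, (1.1) p.76] -/
def covD (R : G → V →ₗ[ℝ] V) (c : ℝ) (U : GaugeField P j G) (μ : Fin P.d) (F : SiteField P j V) : SiteField P j V :=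
  fun x => c • (R (U ⟨x, μ⟩) (F (x.shift μ)) - F x)

/-- THE COVARIANT BACKWARD DERIVATIVE `(D*_{U,μ}F)(x) = c·(R(U(x, x−e_μ)) F(x−e_μ) − F(x))`, where the variable of the reversed
bond is `U(x, x−e_μ) = U(x−e_μ, x)⁻¹`. [cite: Balaban1985RegularSpaces, (1.1) p.76] -/
def covDAdj (R : G → V →ₗ[ℝ] V) (c : ℝ) (U : GaugeField P j G) (μ : Fin P.d) (F : SiteField P j V) : SiteField P j V :=
  fun x => c • (R (U ⟨x.unshift μ, μ⟩)⁻¹ (F (x.unshift μ)) - F x)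

/-- THE COVARIANT DIVERGENCE of a plaquette function, a bond field:
`(D*_U F)_μ(x) = Σ_{ν<μ} (D*_{U,ν} F_{νμ})(x) − Σ_{ν>μ} (D*_{U,ν} F_{μν})(x)`, `F_{μν}(x) = F(p_{μν}(x))` for `μ < ν`. [cite: Balaban1985RegularSpaces, (1.2) p.76] -/
def covDivPlaq (R : G → V →ₗ[ℝ] V) (c : ℝ) (U : GaugeField P j G) (F : Plaq P j → V) : VecField P j V :=
  fun b => (∑ ν : Fin P.d, if h : ν < b.dir then covDAdj R c U ν (fun z => F ⟨z, ν, b.dir, h⟩) b.src else 0)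
    - ∑ ν : Fin P.d, if h : b.dir < ν then covDAdj R c U ν (fun z => F ⟨z, b.dir, ν, h⟩) b.src else 0

/-- At the trivial background and a representation with `R(1) = 1` the covariant forward derivative is `∂_μ`. [cite: Balaban1985RegularSpaces, (1.1) p.76] -/
theorem covD_one (R : G → V →ₗ[ℝ] V) (hR : R 1 = LinearMap.id) (c : ℝ) (μ : Fin P.d) (F : SiteField P j V) :
    covD R c (1 : GaugeField P j G) μ F = pdiff c μ F := by
  funext x
  show c • (R 1 (F (x.shift μ)) - F x) = _
  rw [hR]; rfl

/-- At the trivial background and `R(1) = 1` the covariant backward derivative is `∂*_μ`. [cite: Balaban1985RegularSpaces, (1.1) p.76] -/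
theorem covDAdj_one (R : G → V →ₗ[ℝ] V) (hR : R 1 = LinearMap.id) (c : ℝ) (μ : Fin P.d) (F : SiteField P j V) :
    covDAdj R c (1 : GaugeField P j G) μ F = pdiffAdj c μ F := by
  funext x
  show c • (R (1 : G)⁻¹ (F (x.unshift μ)) - F x) = _
  rw [inv_one, hR]; rfl

end Covariant

/-! ## 8. Scalar fields minimally coupled to an abelian vector field: the `(Higgs)₂,₃` lattice action and the covariant
objects of [Balaban1982Higgs1] (1.3)–(1.8), (1.11) and [Balaban1983RegularityDecay] (1.2)–(1.4) -/

section Scalar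

variable {P : Params} {j : ℕ} {W : Type*} [NormedAddCommGroup W] [InnerProductSpace ℝ W]

/-- The `ℓ^∞` TORUS DISTANCE in lattice steps, `|x − y| = max_μ min{|x_μ − y_μ|, 2L_μ − |x_μ − y_μ|}` ([Balaban1982Higgs1] (1.3);
`Setup.Site.tdist` is the `ℓ¹` variant, DIVERGENCE F2). [cite: Balaban1982Higgs1, (1.3) p.604] -/
def supDist (x y : Site P j) : ℕ :=
  Finset.univ.sup fun μ : Fin P.d => min (x μ - y μ).val (y μ - x μ).val

/-- THE COVARIANT DERIVATIVE OF A SCALAR FIELD along an abelian vector field: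
`(D_A φ)(b) = c·(U(A_b) φ(b₊) − φ(b₋))`, `b = ⟨b₋, b₊⟩`, where `U : ℝ → End(W)` is the representation `U(A) = exp(q ε e A)` of
the additive group `ℝ` on `W = ℝ^N` (`q` antisymmetric, `e` the coupling constant; passed as the parameter `Urep`) and `c = ε⁻¹`
([Balaban1982Higgs1] (1.7); [Balaban1983RegularityDecay] (1.2)–(1.3) with `η` in place of `ε`). [cite: Balaban1982Higgs1, (1.7) p.605] -/
def covDerivScalar (c : ℝ) (Urep : ℝ → W →ₗ[ℝ] W) (A : VecField P j ℝ) (φ : SiteField P j W) : VecField P j W :=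
  fun b => c • (Urep (A b) (φ b.tgt) - φ b.src)

/-- THE COVARIANT LAPLACIAN AS A QUADRATIC FORM: `⟨φ, (−Δ_A)φ⟩ = Σ_b η^d |(D_A φ)(b)|²` (Neumann form on the set of bonds summed
over; here the whole torus), weight `w = η^d` ([Balaban1983RegularityDecay] (1.3); [Balaban1982Higgs1] p. 605 "`−Δ_A = D*_A D_A` is
the covariant Laplace operator"). [cite: Balaban1983RegularityDecay, (1.3) p.572] -/
noncomputable def covLaplaceForm (w c : ℝ) (Urep : ℝ → W →ₗ[ℝ] W) (A : VecField P j ℝ) (φ : SiteField P j W) : ℝ :=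
  ∑ b : PBond P j, w * ‖covDerivScalar c Urep A φ b‖ ^ 2

/-- THE COVARIANT AVERAGING OPERATOR `(Q(A)φ)(y) = Σ_{x ∈ B(y)} L^{-d} U(A(Γ_{y,x})) φ(x)` ([Balaban1983RegularityDecay] (1.4),
one level, `η^d`-weighted sum over the `η`-points of a unit cube = `L^{-d}`-weighted sum over a block), with the staircase
contours `Γ_{y,x}` of `stairSum` (centred blocks, DIVERGENCE F3). [cite: Balaban1983RegularityDecay, (1.4) p.572] -/
noncomputable def covSiteAvg (Urep : ℝ → W →ₗ[ℝ] W) (A : VecField P j ℝ) (φ : SiteField P j W) : SiteField P (j + 1) W :=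
  fun y => (((P.L : ℝ) ^ P.d)⁻¹) • ∑ r : Fin P.d → Fin P.L,
    Urep (stairSum A (emb y) (Site.blockSite y r)) (φ (Site.blockSite y r))

/-- THE `(Higgs)₂,₃` LATTICE ACTION
`S'^ε(A, φ) = ½ Σ_b ε^d |(D_A φ)(b)|² + Σ_x ε^d (½ m₀² |φ(x)|² + λ |φ(x)|⁴) + ½ Σ_P ε^d |(∂A)(P)|² + ½ Σ_b ε^d μ₀² |A_b|²`,
weight `w = ε^d`, lattice factor `c = ε⁻¹` inside `D_A` and `∂`. [cite: Balaban1982Higgs1, (1.8) p.605] -/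
noncomputable def higgsAction (w c : ℝ) (Urep : ℝ → W →ₗ[ℝ] W) (m0sq lam mu0sq : ℝ) (A : VecField P j ℝ)
    (φ : SiteField P j W) : ℝ :=
  (1 / 2) * covLaplaceForm w c Urep A φ
    + ∑ x : Site P j, w * ((1 / 2) * m0sq * ‖φ x‖ ^ 2 + lam * ‖φ x‖ ^ 4)
    + curlAction w c A
    + (1 / 2) * ∑ b : PBond P j, w * (mu0sq * (A b) ^ 2)

/-- THE FEYNMAN-GAUGE ACTION `S(A, φ) = ½⟨φ, (−Δ_A)φ⟩ + Σ_x ε^d(½ m₀²|φ(x)|² + λ|φ(x)|⁴) + ½⟨A, (−Δ + μ₀²)A⟩ + E` of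
[Balaban1982Higgs1] (1.11), with `⟨A, −ΔA⟩ = Σ_μ ⟨A_μ, −ΔA_μ⟩ = Σ_{x,μ,ν} ε^d |(∂_ν A_μ)(x)|²` written as the quadratic form of
the forward differences (`−Δ = ∂*∂`, p. 605) and the constant `E = E₀ + E₁` a parameter. [cite: Balaban1982Higgs1, (1.11) p.605] -/
noncomputable def feynmanHiggsAction (w c : ℝ) (Urep : ℝ → W →ₗ[ℝ] W) (m0sq lam mu0sq E : ℝ) (A : VecField P j ℝ)
    (φ : SiteField P j W) : ℝ :=
  (1 / 2) * covLaplaceForm w c Urep A φ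
    + ∑ x : Site P j, w * ((1 / 2) * m0sq * ‖φ x‖ ^ 2 + lam * ‖φ x‖ ^ 4)
    + (1 / 2) * (∑ x : Site P j, ∑ μ : Fin P.d, ∑ ν : Fin P.d, w * (pdiff c ν (fun z => A ⟨z, μ⟩) x) ^ 2
        + ∑ b : PBond P j, w * (mu0sq * (A b) ^ 2))
    + E

/-- At `A = 0` and `U(0) = 1` the covariant derivative is the plain gradient `∂φ`. [cite: Balaban1982Higgs1, (1.7) p.605] -/
theorem covDerivScalar_zero (c : ℝ) (Urep : ℝ → W →ₗ[ℝ] W) (h0 : Urep 0 = LinearMap.id) (φ : SiteField P j W) :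
    covDerivScalar c Urep (fun _ => (0 : ℝ)) φ = grad c φ := by
  funext b
  simp [covDerivScalar, grad, h0]

/-- At `A = 0` and `U(0) = 1` the covariant average is the block average `Q'`. [cite: Balaban1983RegularityDecay, (1.4) p.572] -/
theorem covSiteAvg_zero (Urep : ℝ → W →ₗ[ℝ] W) (h0 : Urep 0 = LinearMap.id) (φ : SiteField P j W) :
    covSiteAvg Urep (fun _ => (0 : ℝ)) φ = siteAvg φ := by
  funext y
  have hs : ∀ x : Site P j, stairSum (fun _ : PBond P j => (0 : ℝ)) (emb y) x = 0 := fun x => by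
    unfold stairSum
    refine Finset.sum_eq_zero fun μ _ => ?_
    rcases ((x μ - emb y μ).valMinAbs) with n | n <;> simp [runSum]
  simp only [covSiteAvg, siteAvg, hs, h0, LinearMap.id_apply]

/-- The Higgs action (1.8) is bounded below by `0` when `m₀², λ, μ₀² ≥ 0` and `ε^d ≥ 0` (the printed model takes `μ₀² > 0`, `λ > 0`
and `m₀² = m² + δm²` with a counterterm; this elementary bound covers only the no-counterterm case `m₀² ≥ 0`). [cite: Balaban1982Higgs1, (1.8) p.605] -/
theorem higgsAction_nonneg {w m0sq lam mu0sq : ℝ} (hw : 0 ≤ w) (hm : 0 ≤ m0sq) (hl : 0 ≤ lam) (hmu : 0 ≤ mu0sq) (c : ℝ)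
    (Urep : ℝ → W →ₗ[ℝ] W) (A : VecField P j ℝ) (φ : SiteField P j W) :
    0 ≤ higgsAction w c Urep m0sq lam mu0sq A φ := by
  unfold higgsAction covLaplaceForm
  have h1 : 0 ≤ ∑ b : PBond P j, w * ‖covDerivScalar c Urep A φ b‖ ^ 2 :=
    Finset.sum_nonneg fun b _ => mul_nonneg hw (sq_nonneg _)
  have h2 : 0 ≤ ∑ x : Site P j, w * ((1 / 2) * m0sq * ‖φ x‖ ^ 2 + lam * ‖φ x‖ ^ 4) :=
    Finset.sum_nonneg fun x _ => mul_nonneg hw (by positivity)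
  have h3 := curlAction_nonneg hw c A
  have h4 : 0 ≤ ∑ b : PBond P j, w * (mu0sq * (A b) ^ 2) :=
    Finset.sum_nonneg fun b _ => mul_nonneg hw (mul_nonneg hmu (sq_nonneg _))
  positivity

end Scalar

/-! ## 9. (v1.1) The full linear average of [Balaban1984PropagatorsI] (1.8) = [Balaban1985Averaging] (14), and the abelian block
LANDAU gauge of [Balaban1984PropagatorsI] Sect. C / [Balaban1984PropagatorsII] (2.8)–(2.9) (= [Balaban1985RegularSpaces] (1.27) at `U₀ = 1`) -/

section FullAverage

variable {P : Params} {j : ℕ} {V : Type*} [AddCommGroup V] [Module ℝ V]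

/-- THE FULL LINEAR AVERAGE `B_c = Σ_{x ∈ B(c₋)} L^{-(d+1)} (A(Γ_{c₋,x}) + A([x, x(c)]) + A(Γ_{x(c),c₊}))` ([Balaban1984PropagatorsI] (1.8);
[Balaban1985Averaging] (14): "`Γ_{c₋,x} ∪ [x, x(c)] ∪ Γ_{x(c),c₊}` is an oriented contour with `c₋` as an initial point and `c₊` as a final
point"), the third leg being the staircase from `x(c)` back to the block centre `c₊`, i.e. MINUS `A(Γ_{c₊,x(c)})`; `x(c)` = the site with the
same offset in `B(c₊)` (`runSite_blockSite_L`); centred blocks (DIVERGENCE F3). [cite: Balaban1984PropagatorsI, (1.8) p.19] -/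
noncomputable def fullBondAvg (A : VecField P j V) : VecField P (j + 1) V :=
  fun c => (((P.L : ℝ) ^ (P.d + 1))⁻¹) • ∑ r : Fin P.d → Fin P.L,
    (stairSum A (emb c.src) (Site.blockSite c.src r) + segSum A (Site.blockSite c.src r) c.dir P.L
      - stairSum A (emb c.tgt) (Site.blockSite c.tgt r))

/-- IN THE AXIAL GAUGE THE FULL AVERAGE (1.8) IS `Q` (1.11): the staircase legs vanish ("fixing the average … we remove it by
introducing Axial (Ax) gauge fixing conditions `A(Γ_{y,x}) = 0`", then "we may define the averaging operation as given by `Q`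
directly", [Balaban1984PropagatorsI] p. 19). [cite: Balaban1984PropagatorsI, (1.11) p.19] -/
theorem fullBondAvg_of_isAxial {A : VecField P j V} (hA : IsAxial A) : fullBondAvg A = bondAvg A := by
  funext c
  unfold fullBondAvg bondAvg
  congr 1
  refine Finset.sum_congr rfl fun r _ => ?_
  have h1 : stairSum A (emb c.src) (Site.blockSite c.src r) = 0 := by
    by_cases h : Site.blockSite c.src r = emb c.src
    · rw [h, stairSum_self]
    · exact hA c.src r h
  have h2 : stairSum A (emb c.tgt) (Site.blockSite c.tgt r) = 0 := by
    by_cases h : Site.blockSite c.tgt r = emb c.tgt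
    · rw [h, stairSum_self]
    · exact hA c.tgt r h
  rw [h1, h2, zero_add, sub_zero]

/-- `∂*∂ = Δ`: the divergence of a gradient is the Laplacian ([Balaban1984PropagatorsI] (1.21) "`Δ` is `η`-lattice Laplace operator";
[Balaban1984PropagatorsII] (2.8): `∂*A^λ = ∂*A − Δλ`). [cite: Balaban1984PropagatorsII, (2.8) p.224] -/
theorem diverg_grad (c : ℝ) (lam : SiteField P j V) : diverg c (grad c lam) = laplace c lam := by
  funext x
  simp only [diverg, grad, laplace, PBond.tgt, shift_unshift]
  refine Finset.sum_congr rfl fun μ _ => ?_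
  module

/-- `∂*` is additive. [cite: Balaban1984PropagatorsI, (1.21) p.21] -/
theorem diverg_sub (c : ℝ) (A B : VecField P j V) :
    diverg c (fun b => A b - B b) = fun x => diverg c A x - diverg c B x := by
  funext x
  simp only [diverg, ← Finset.sum_sub_distrib]
  refine Finset.sum_congr rfl fun μ _ => ?_
  module

/-- `∂*A^λ = ∂*A − Δλ` ([Balaban1984PropagatorsII] (2.8)). [cite: Balaban1984PropagatorsII, (2.8) p.224] -/
theorem diverg_gaugeShift (c : ℝ) (lam : SiteField P j V) (A : VecField P j V) :
    diverg c (gaugeShift c lam A) = fun x => diverg c A x - laplace c lam x := by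
  have h : gaugeShift c lam A = fun b => A b - grad c lam b := rfl
  rw [h, diverg_sub, diverg_grad]

end FullAverage

section Landau

variable {P : Params} {j : ℕ}

/-- THE LANDAU-GAUGE FUNCTIONAL `λ ↦ Σ_x η^d |(∂*A^λ)(x)|² = Σ_x η^d |(∂*A)(x) − (Δλ)(x)|²` ([Balaban1984PropagatorsII] (2.8); the same
infimum appears in [Balaban1984PropagatorsI] (1.24)): its minimum over the admissible gauge functions selects the gauge. [cite: Balaban1984PropagatorsII, (2.8) p.224] -/
noncomputable def landauFunctional (w c : ℝ) (A : VecField P j ℝ) (lam : SiteField P j ℝ) : ℝ :=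
  ∑ x : Site P j, w * (diverg c (gaugeShift c lam A) x) ^ 2

/-- The functional in the printed second form `Σ_x η^d |(∂*A)(x) − (Δλ)(x)|²`. [cite: Balaban1984PropagatorsII, (2.8) p.224] -/
theorem landauFunctional_eq (w c : ℝ) (A : VecField P j ℝ) (lam : SiteField P j ℝ) :
    landauFunctional w c A lam = ∑ x : Site P j, w * (diverg c A x - laplace c lam x) ^ 2 := by
  unfold landauFunctional
  rw [diverg_gaugeShift]

/-- THE (generalized, block) LANDAU GAUGE CONDITION, abelian, ONE LEVEL (`k = 1`, `Ω₁ = T_η` in [Balaban1984PropagatorsII]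
(2.1)–(2.9); `R∂*A = 0` of [Balaban1984PropagatorsI] Sect. C–D; [Balaban1985RegularSpaces] (1.27) at `U₀ = 1`): `R` is the orthogonal
projection onto `Δ N(Q')`, `N(Q') = {λ : Q'λ = 0}`, so `R∂*A = 0` reads `∂*A ⊥ Δδλ` for all `δλ` with `Q'δλ = 0` — the variational equation
(2.9) `Σ_x η^d (Δδλ)(x)((∂*A)(x) − (Δλ₀)(x)) = 0` at `λ₀ = 0`.  TODO(general form): the multi-domain constraints `λ = 0` on `Λ₀`,
`Q'_jλ = 0` on `Λ_j` of (2.7)–(2.8) need the domain sequences (2.1)–(2.4). [cite: Balaban1984PropagatorsII, (2.9) p.224] -/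
def IsLandauGauge (c : ℝ) (A : VecField P j ℝ) : Prop :=
  ∀ dl : SiteField P j ℝ, siteAvg dl = 0 → ∑ x : Site P j, laplace c dl x * diverg c A x = 0

/-- The zero field is in the Landau gauge. [cite: Balaban1984PropagatorsII, (2.9) p.224] -/
theorem isLandauGauge_zero (c : ℝ) : IsLandauGauge (P := P) (j := j) c (fun _ => 0) := by
  intro dl _
  simp [diverg]

end Landau

/-! ## 10. v1.2 (append-only): the adjoint `Q_k^*(A)` and the projection `P_k(A) = Q_k^*(A)Q_k(A)` of [Balaban1983RegularityDecay] (1.5)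
(lit-balaban lead R8 = SKELETON-r18 row A12b; one level `k = 1` on the tori of `Setup`, standing range `j + 1 ≤ m + K`). -/

section CovariantProjection

variable {P : Params} {j : ℕ} {W : Type*} [NormedAddCommGroup W] [InnerProductSpace ℝ W]

/-- THE ADJOINT COVARIANT AVERAGING OPERATOR `Q(A)^*`: for the inner products `⟨φ₁, φ₂⟩ = Σ_x η^d φ₁(x)·φ₂(x)` (fine lattice) and
`Σ_y (Lη)^d ψ₁(y)·ψ₂(y)` (block lattice) the adjoint of (1.4) is `(Q(A)^*ψ)(x) = U(A(Γ_{y,x}))^* ψ(y)`, `x ∈ B(y)`, and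
`U(A)^* = U(−A)` ([Balaban1983RegularityDecay] (1.2): "q is an antisymmetric N × N matrix"; [Balaban1982Higgs1] p. 605) — so no
adjoint structure on `W` is needed: `U(−A(Γ_{y,x}))` applied to `ψ(y)`, `y = blockOf x`. [cite: Balaban1983RegularityDecay, (1.5) p.572] -/
noncomputable def covSiteAvgAdj (Urep : ℝ → W →ₗ[ℝ] W) (A : VecField P j ℝ) (ψ : SiteField P (j + 1) W) : SiteField P j W :=
  fun x => Urep (-(stairSum A (emb (blockOf x)) x)) (ψ (blockOf x))

/-- THE PROJECTION OPERATOR `P_k(A) = Q_k^*(A)Q_k(A)` of [Balaban1983RegularityDecay] (1.5) (verbatim: *"The projection operator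
P_k(A) is given by P_k(A) = Q_k^*(A)Q_k(A). (1.5)"*), one level. [cite: Balaban1983RegularityDecay, (1.5) p.572] -/
noncomputable def covProj (Urep : ℝ → W →ₗ[ℝ] W) (A : VecField P j ℝ) (φ : SiteField P j W) : SiteField P j W :=
  covSiteAvgAdj Urep A (covSiteAvg Urep A φ)

/-- kernel (plumbing): a sum over the fine torus is the sum over blocks of the sums over block offsets (standing range). [folklore] -/
private theorem sum_blockSite {M : Type*} [AddCommMonoid M] (hj : j + 1 ≤ P.m + P.K) (F : Site P j → M) :
    ∑ x, F x = ∑ y : Site P (j + 1), ∑ r : Fin P.d → Fin P.L, F (Site.blockSite y r) := by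
  rw [← Finset.sum_fiberwise_of_maps_to (s := Finset.univ) (t := Finset.univ) (g := blockOf) (fun _ _ => Finset.mem_univ _) F]
  refine Finset.sum_congr rfl fun y _ => ?_
  have hmem : ∀ x : Site P j, blockOf x = y ↔ x ∈ ({x ∈ Finset.univ | blockOf x = y} : Finset (Site P j)) := fun x => by simp
  let e : (Fin P.d → Fin P.L) ≃ ↥({x ∈ Finset.univ | blockOf x = y} : Finset (Site P j)) :=
    (Site.blockEquiv hj y).symm.trans (Equiv.subtypeEquivRight hmem)
  rw [← Finset.sum_coe_sort _ F, ← Equiv.sum_comp e (fun a => F a.1)]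
  exact Finset.sum_congr rfl fun r _ => rfl

/-- `Q(A)^*` IS THE ADJOINT OF `Q(A)`: `Σ_y ⟨(Q(A)φ)(y), ψ(y)⟩ = L^{−d} Σ_x ⟨φ(x), (Q(A)^*ψ)(x)⟩`, i.e. with the weights `(Lη)^d = L^d·η^d`
of the two lattices, `⟨Q(A)φ, ψ⟩_{Lη} = ⟨φ, Q(A)^*ψ⟩_η` — given that `U(−a)` is the adjoint of `U(a)` on `W` (antisymmetry of `q`).
Standing range `j + 1 ≤ m + K`. [cite: Balaban1983RegularityDecay, (1.5) p.572] -/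
theorem covSiteAvg_adjoint (hj : j + 1 ≤ P.m + P.K) (Urep : ℝ → W →ₗ[ℝ] W)
    (hU : ∀ (a : ℝ) (v w : W), @inner ℝ W _ (Urep a v) w = @inner ℝ W _ v (Urep (-a) w)) (A : VecField P j ℝ) (φ : SiteField P j W)
    (ψ : SiteField P (j + 1) W) :
    ∑ y, @inner ℝ W _ (covSiteAvg Urep A φ y) (ψ y) = ((P.L : ℝ) ^ P.d)⁻¹ * ∑ x, @inner ℝ W _ (φ x) (covSiteAvgAdj Urep A ψ x) := by
  rw [sum_blockSite hj, Finset.mul_sum]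
  refine Finset.sum_congr rfl fun y _ => ?_
  simp only [covSiteAvg, covSiteAvgAdj, inner_smul_left, sum_inner, map_inv₀, map_pow, RCLike.conj_to_real,
    Site.blockOf_blockSite hj, hU]

/-- `Q(A)Q(A)^* = I` (the averaging is a co-isometry; whence `P_k(A)` is a projection): given `U(a)U(−a) = 1` on `W`.
Standing range. [cite: Balaban1983RegularityDecay, (1.5) p.572] -/
theorem covSiteAvg_covSiteAvgAdj (hj : j + 1 ≤ P.m + P.K) (Urep : ℝ → W →ₗ[ℝ] W) (hUU : ∀ (a : ℝ) (w : W), Urep a (Urep (-a) w) = w)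
    (A : VecField P j ℝ) (ψ : SiteField P (j + 1) W) : covSiteAvg Urep A (covSiteAvgAdj Urep A ψ) = ψ := by
  funext y
  simp only [covSiteAvg, covSiteAvgAdj, Site.blockOf_blockSite hj, hUU, Finset.sum_const, Finset.card_univ, Fintype.card_fun,
    Fintype.card_fin]
  rw [← Nat.cast_smul_eq_nsmul ℝ, smul_smul]
  have hL : ((P.L : ℝ) ^ P.d) ≠ 0 := pow_ne_zero _ (Nat.cast_ne_zero.mpr P.L_pos.ne')
  rw [Nat.cast_pow, inv_mul_cancel₀ hL, one_smul]

/-- `P_k(A)` IS IDEMPOTENT, `P_k(A)² = P_k(A)` ("projection operator", (1.5)) — from `Q(A)Q(A)^* = I`. Standing range.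
[cite: Balaban1983RegularityDecay, (1.5) p.572] -/
theorem covProj_idem (hj : j + 1 ≤ P.m + P.K) (Urep : ℝ → W →ₗ[ℝ] W) (hUU : ∀ (a : ℝ) (w : W), Urep a (Urep (-a) w) = w)
    (A : VecField P j ℝ) (φ : SiteField P j W) : covProj Urep A (covProj Urep A φ) = covProj Urep A φ := by
  unfold covProj
  rw [covSiteAvg_covSiteAvgAdj hj Urep hUU]

/-- kernel (plumbing): the zero field has zero run sums. [folklore] -/
private theorem runSum_zero_field (x : Site P j) (μ : Fin P.d) : ∀ n : ℤ, runSum (fun _ : PBond P j => (0 : ℝ)) x μ n = 0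
  | (n : ℕ) => by simp [runSum]
  | Int.negSucc n => by simp [runSum]

/-- At `A = 0` (`U(0) = 1`) the adjoint is the block-constant extension `(Q'^*ψ)(x) = ψ(y)`, `x ∈ B(y)` ([Balaban1984PropagatorsI]
(1.15): "defining λ on T₁ as constant on each block"). [cite: Balaban1984PropagatorsI, (1.15) p.19] -/
theorem covSiteAvgAdj_zero (Urep : ℝ → W →ₗ[ℝ] W) (h0 : Urep 0 = LinearMap.id) (ψ : SiteField P (j + 1) W) :
    covSiteAvgAdj Urep (fun _ => (0 : ℝ)) ψ = fun x => ψ (blockOf x) := by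
  funext x
  have hs : stairSum (fun _ : PBond P j => (0 : ℝ)) (emb (blockOf x)) x = 0 := by
    simp [stairSum, runSum_zero_field]
  simp [covSiteAvgAdj, hs, h0]

end CovariantProjection

end LatticeFieldCalculus

end Literature.MathematicalPhysics.QuantumFieldTheory.Balaban1983to89
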